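import Literature.Probability.RandomPlanarGeometry.SAWCountZdSymbolFirstCancellation
import Literature.Probability.RandomPlanarGeometry.SAWCountZdFifthCoefficientReduction
import HarnessLib

/-!
# STIRLING SECOND LAYER: `[X^{2k−1}] E_k = (−1)^{k+1} k(2k+1)/(3·2^k·k!)` for every `k ≥ 1`, and `E₂` in closed form

Topic `Literature/Probability/RandomPlanarGeometry` (the «SYMBOL POLYNOMIALITY» programme; continues `SAWCountZdSymbolFirstCancellation.lean` (a-p1 g26: the explicit
Stirling polynomials `stirlingPoly k` with `[X^{m−k}] (X)_m = E_k(m)`, `natDegree_stirlingPoly : = 2k`, `leadingCoeff_stirlingPoly : = (−1)^k/(2^k k!)`, the summation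
operator `sumPoly` with `coeff_sumPoly_natDegree_succ`, the Faulhaber polynomials `faulhaberPoly`) and uses `SAWCountZdFifthCoefficientReduction.lean` (a-p1 g22:
`descPochhammer_coeff_pred_pred : [X^u] (X)_{u+2} = (u+2)(u+1)u(3u+5)/24`)).

PRINTED CONTEXT (locators only; nothing is quoted digit-for-digit). Stanley, EC1 (2nd ed.) §1.3 Lemma 1.3.6 (recurrence of `c(n,k)`), Proposition 1.3.7 eq. (1.28)
(`Σ_k c(n,k) t^k = t(t+1)⋯(t+n−1)`), Exercise 1.43 (`c(n,n−1)`, `c(n,n−2)`). The two-term expansion `s(m, m−k) = (−1)^k/(2^k k!)·(m^{2k} − k(2k+1)/3·m^{2k−1} + …)`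
is classical (Stirling polynomials; not held in print by the lane's desks as a formula with locator) — proved here from the recurrence via Faulhaber's second
coefficient `B₁ = −1/2`. Madras–Slade (1993) §1.1 eq. (1.1.8) p. 5 for the `1/d` context.

THE THEOREM. ★ `coeff_faulhaberPoly_self : [X^p] F_p = −1/2` (`p ≥ 1`); ★ `coeff_sumPoly_natDegree : [X^{deg q}] sumPoly q = [X^{deg q −1}] q / deg q − lc(q)/2`;
★★ `coeff_stirlingPoly_succ_two_mul_add_one` / `coeff_stirlingPoly_two_mul_sub_one` — **`[X^{2k−1}] E_k = (−1)^{k+1} k(2k+1)/(3·2^k·k!)`** for every `k ≥ 1`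
(the recursion `b_{k+1} = a_k/2 − b_k/(2k+1)` on second coefficients closes to `b_k = −k(2k+1)/3 · a_k`: `coeff_stirlingPoly_two_mul_sub_one_eq_mul_leadingCoeff`);
`stirlingPoly_two : E₂ = X(X−1)(X−2)(3X−1)/24`. This is the Stirling input of the SECOND CANCELLATION (`SAWCountZdSymbolSecondCancellation.lean`).

THIS FILE (lane «pcv-sawmu», a-p1 g26; all PROVED, standard axioms): `coeff_faulhaberPoly_self`, `coeff_sumPoly_natDegree`, ★★ `coeff_stirlingPoly_succ_two_mul_add_one`,
★★ `coeff_stirlingPoly_two_mul_sub_one`, `coeff_stirlingPoly_two_mul_sub_one_eq_mul_leadingCoeff`, `stirlingPoly_two`.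
[cite: Stanley2012EC1, §1.3 Lemma 1.3.6; Prop. 1.3.7 eq. (1.28); Exercise 1.43] [cite: MadrasSlade1993, §1.1 eq. (1.1.8) p. 5]

Provenance: lane «pcv-sawmu», a-p1 g26 (2026-08-28).
-/

noncomputable section

open Finset
open scoped BigOperators
open Literature.Probability.LatticeModels
open Literature.Probability.RandomPlanarGeometry.SAW
open Literature.Probability.Percolation

namespace Literature.Probability.RandomPlanarGeometry.SAW.Zd

namespace WordTypes

/-! ### The second Faulhaber coefficient and the second coefficient of the summation operator -/

/-- `[X^p] F_p = B₁ = −1/2` for `p ≥ 1` (`Σ_{k<m} k^p = m^{p+1}/(p+1) − m^p/2 + …`). [cite: Stanley2012EC1, §1.3 Prop. 1.3.7 eq. (1.28); lane plumbing] -/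
theorem coeff_faulhaberPoly_self (p : ℕ) (hp : 1 ≤ p) : (faulhaberPoly p).coeff p = -1 / 2 := by
  unfold faulhaberPoly
  rw [Polynomial.finsetSum_coeff, Finset.sum_eq_single 1]
  · rw [Polynomial.coeff_C_mul, Polynomial.coeff_X_pow, if_pos (by omega), _root_.bernoulli_one, Nat.choose_one_right]
    push_cast
    have : ((p : ℚ) + 1) ≠ 0 := by positivity
    field_simp
  · intro i _ hi
    rw [Polynomial.coeff_C_mul, Polynomial.coeff_X_pow, if_neg (by omega), mul_zero]
  · intro h; exact absurd (Finset.mem_range.2 (by omega : 1 < p + 1)) h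

/-- The second coefficient of the sum: `[X^{deg q}] sumPoly q = [X^{deg q − 1}] q / deg q − lc(q)/2` (`deg q ≥ 1`).
[cite: Stanley2012EC1, §1.3 Prop. 1.3.7 eq. (1.28); lane plumbing] -/
theorem coeff_sumPoly_natDegree (q : Polynomial ℚ) (hq : 1 ≤ q.natDegree) :
    (sumPoly q).coeff q.natDegree = q.coeff (q.natDegree - 1) / (q.natDegree : ℚ) - q.leadingCoeff / 2 := by
  unfold sumPoly
  rw [Polynomial.finsetSum_coeff]
  obtain ⟨D, hD⟩ : ∃ D, q.natDegree = D + 1 := ⟨q.natDegree - 1, by omega⟩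
  rw [hD, Finset.sum_range_succ, Finset.sum_range_succ, Finset.sum_eq_zero, zero_add, Polynomial.coeff_C_mul, Polynomial.coeff_C_mul,
    coeff_faulhaberPoly_succ, coeff_faulhaberPoly_self (D + 1) (by omega), Polynomial.leadingCoeff, hD, Nat.add_sub_cancel]
  · push_cast; ring
  · intro p hp
    rw [Polynomial.coeff_C_mul, Polynomial.coeff_eq_zero_of_natDegree_lt ((natDegree_faulhaberPoly_le p).trans_lt
      (by have := Finset.mem_range.1 hp; omega)), mul_zero]

/-! ### The second coefficient of the Stirling polynomials -/

/-- The inductive form: `[X^{2k+1}] E_{k+1} = (−1)^k (k+1)(2k+3)/(3·2^{k+1}·(k+1)!)` for every `k` (recursion `b_{k+1} = a_k/2 − b_k/(2k+1)` on the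
second coefficients, `a_k = (−1)^k/(2^k k!)` the leading ones). [cite: Stanley2012EC1, §1.3 Lemma 1.3.6 & Prop. 1.3.7 eq. (1.28); Exercise 1.43; lane lemma] -/
theorem coeff_stirlingPoly_succ_two_mul_add_one (k : ℕ) :
    (stirlingPoly (k + 1)).coeff (2 * k + 1) = (-1) ^ k * (((k : ℚ) + 1) * (2 * k + 3)) / (3 * 2 ^ (k + 1) * ((k + 1).factorial : ℚ)) := by
  induction k with
  | zero =>
    rw [stirlingPoly_one, Polynomial.coeff_C_mul, show (1 : ℕ) = 0 + 1 from rfl, Polynomial.coeff_X_mul, Polynomial.coeff_sub, Polynomial.coeff_X_zero,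
      Polynomial.coeff_one_zero]
    norm_num
  | succ k ih =>
    have hne : stirlingPoly (k + 1) ≠ 0 := stirlingPoly_ne_zero _
    have hXdeg : (Polynomial.X * stirlingPoly (k + 1)).natDegree = 2 * k + 3 := by
      rw [Polynomial.natDegree_X_mul hne, natDegree_stirlingPoly]; ring
    have hXlc : (Polynomial.X * stirlingPoly (k + 1)).leadingCoeff = (-1) ^ (k + 1) / (2 ^ (k + 1) * ((k + 1).factorial : ℚ)) := by
      rw [Polynomial.leadingCoeff_mul, Polynomial.leadingCoeff_X, one_mul, leadingCoeff_stirlingPoly]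
    have hXc : (Polynomial.X * stirlingPoly (k + 1)).coeff (2 * k + 3 - 1) = (stirlingPoly (k + 1)).coeff (2 * k + 1) := by
      rw [show 2 * k + 3 - 1 = (2 * k + 1) + 1 by omega, Polynomial.coeff_X_mul]
    rw [show 2 * (k + 1) + 1 = 2 * k + 3 by ring, stirlingPoly_succ, Polynomial.coeff_sub, Polynomial.coeff_C, if_neg (by omega), zero_sub, ← hXdeg,
      coeff_sumPoly_natDegree _ (by rw [hXdeg]; omega), hXdeg, hXc, ih, hXlc, Nat.factorial_succ (k + 1)]
    push_cast
    have hk : ((k + 1).factorial : ℚ) ≠ 0 := by exact_mod_cast (k + 1).factorial_ne_zero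
    have h3 : (2 : ℚ) * k + 3 ≠ 0 := by positivity
    field_simp
    ring

/-- ★ THE SECOND COEFFICIENT OF THE STIRLING POLYNOMIALS: for every `k ≥ 1`, `[X^{2k−1}] E_k = (−1)^{k+1} k(2k+1)/(3·2^k·k!)`, i.e.
`s(m, m−k) = (−1)^k/(2^k k!)·(m^{2k} − k(2k+1)/3·m^{2k−1} + O(m^{2k−2}))` (`k = 1`: `−m²/2 + m/2`; `k = 2`: `(3m⁴ − 10m³ + …)/24`; `k = 3`: `−(m⁶ − 7m⁵ + …)/48`).
[cite: Stanley2012EC1, §1.3 Lemma 1.3.6 & Prop. 1.3.7 eq. (1.28); Exercise 1.43; lane lemma] -/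
theorem coeff_stirlingPoly_two_mul_sub_one (k : ℕ) (hk : 1 ≤ k) :
    (stirlingPoly k).coeff (2 * k - 1) = (-1) ^ (k + 1) * ((k : ℚ) * (2 * k + 1)) / (3 * 2 ^ k * (k.factorial : ℚ)) := by
  obtain ⟨k, rfl⟩ : ∃ k', k = k' + 1 := ⟨k - 1, by omega⟩
  rw [show 2 * (k + 1) - 1 = 2 * k + 1 by omega, coeff_stirlingPoly_succ_two_mul_add_one]
  push_cast
  ring

/-- In ratio form: `[X^{2k−1}] E_k = −k(2k+1)/3 · lc E_k` for `k ≥ 1`. [cite: Stanley2012EC1, §1.3 Prop. 1.3.7 eq. (1.28); lane lemma] -/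
theorem coeff_stirlingPoly_two_mul_sub_one_eq_mul_leadingCoeff (k : ℕ) (hk : 1 ≤ k) :
    (stirlingPoly k).coeff (2 * k - 1) = -((k : ℚ) * (2 * k + 1) / 3) * (stirlingPoly k).leadingCoeff := by
  rw [coeff_stirlingPoly_two_mul_sub_one k hk, leadingCoeff_stirlingPoly, pow_succ]
  have hf : (k.factorial : ℚ) ≠ 0 := by exact_mod_cast k.factorial_ne_zero
  field_simp

/-- `E₂ = X(X−1)(X−2)(3X−1)/24` (`s(m, m−2) = C(m,3)(3m−1)/4`, the tree's `descPochhammer_coeff_pred_pred`).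
[cite: Stanley2012EC1, §1.3 Exercise 1.43; lane lemma] -/
theorem stirlingPoly_two : stirlingPoly 2 =
    Polynomial.C (1 / 24 : ℚ) * (Polynomial.X * (Polynomial.X - 1) * (Polynomial.X - 2) * (Polynomial.C (3 : ℚ) * Polynomial.X - 1)) := by
  symm
  apply eq_stirlingPoly_of_eval
  intro m hm
  obtain ⟨u, rfl⟩ : ∃ u, m = u + 2 := ⟨m - 2, by omega⟩
  rw [Nat.add_sub_cancel, descPochhammer_coeff_pred_pred]
  simp only [Polynomial.eval_mul, Polynomial.eval_C, Polynomial.eval_sub, Polynomial.eval_X, Polynomial.eval_one, Polynomial.eval_ofNat]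
  push_cast
  ring

end WordTypes

end Literature.Probability.RandomPlanarGeometry.SAW.Zd
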